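import Summits.QuantumFields.BalabanUV.Beta.FP.DecimationTail
import Literature.MathematicalPhysics.QuantumFieldTheory.Balaban1983to89.Beta.CrossTermBounds

/-!
# `BalabanUV.Beta.FP.DecimationSecondMoment` — road «FP» for binder row D1, row N7/H3-BOOK (b4′) part 1: THE «SECOND BRACKET» OF THE TAIL —
# the windowed second moment of the RESCALED kernel `v ↦ N⁶·K(N•v)` against the window function `g M := Σ_{0<‖z‖∞≤M} z_μ z_ν K_{μν}(z)`:
# decay gives `g(N·R) − g(N)` up to `O(1)` (decimation lemma), and the log-asymptotics letter `hgerm` turns that into `g(R) − c₀` up to `O(1)`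

HONEST DEPENDENCY (page 1, mandatory): continuum YM on T⁴ ⇐ BetaPertH ∧ nine spine estimates (0/9 proved); BetaPertH ⇐ (D1) ∧ (D4) ∧
CAP+tail; G-an2-4 gates asym, D1 and NE2/3/4.  HONEST FRAMING (cell contract, verbatim): «discharging `BetaPertH` makes Bałaban's UV
stability UNCONDITIONAL — a real constructive-QFT result; it is NOT the continuum limit and NOT the Clay problem.»  THIS MODULE is elementary
[folklore] lattice analysis on `ℤ⁴` (finite sums only); it asserts nothing about Bałaban's objects, cites nothing, mints no `Prop` fact, no `def`;
0 `sorry`.  The log-asymptotics of the window function (`hgerm`, = `FP/HorizontalEnd`'s hypothesis, road FP row H2-OBJ) is a HYPOTHESIS here.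
FINDING F-d1leaf05g8-1 (journal 2026-08-20, GAPS § F-d1leaf05g8-1): with decay hypotheses ALONE the second bracket drifts like `log log N`
(counterexample `K = (1 + 1∕log(‖z‖∞+3))·(‖z‖∞+1)⁻⁶`); `hgerm` is what bounds it.  NOT hbook, NOT hasym, NOT D1, NOT BetaPertH, NOT continuum, NOT Clay.

ABSOLUTE RULE (cell charter, verbatim): «No internally-minted statement may enter as a cited fact. Every hypothesis is either kernel-proved in this
package or a verbatim quotation of a PUBLISHED theorem with page reference. The manuscript(s) under audit are NOT citable for their own disputed
steps — they are the thing under adjudication; programme-internal (2001/route/tribunal) claims are never citable.»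

WHAT IS HERE.  `K : Fin 4 → Fin 4 → ℤ⁴ → ℝ` (= `DressedMomentNormalisation.EKer 4` definitionally), a channel `(μ, ν)`, decay letters
`hK : |K μ ν z| ≤ C∕(‖z‖∞+1)⁶`, `hdK : |K μ ν (z + e_i) − K μ ν z| ≤ C∕(‖z‖∞+1)⁷`.
* §1 the moment weight `z ↦ K μ ν z · z_μ · z_ν` (the summand of `B12Beta.secondMoment`) has `|·| ≤ C∕(‖z‖∞+1)⁴` and first differences `≤ 3C∕(‖z‖∞+1)⁵`
  (`abs_momentWeight_le`, `abs_fwdDiff_momentWeight_le`; the coordinate bound is `CrossTermBounds.abs_cast_apply_le_supNorm` BY NAME).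
* §2 **`abs_rescaled_window_sub_le`**: for all `N, R ≥ 1`,
  `|Σ_{v ∈ annulus 4 1 R} (N⁶·K μ ν (N•v))·v_μ·v_ν − (g (N·R) − g N)| ≤ 67392·C`, `g M := Σ_{z ∈ annulus 4 0 M} K μ ν z·z_μ·z_ν`
  (`FP/DecimationTail.decimation_tail_window` on §1).
* §3 **`abs_rescaled_window_sub_germ_le`**: with the letter `hgerm : ∀ M ≥ 1, |g M − (s·log M + c₀)| ≤ Cg`,
  `|Σ_{v ∈ annulus 4 1 R} (N⁶·K μ ν (N•v))·v_μ·v_ν − (g R − c₀)| ≤ 3·Cg + 67392·C` for all `N, R ≥ 1` (`log (N·R) = log N + log R`).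
Provenance: D1 formalisation swarm, unit b2b-balaban-beta-d1-formalise-leaf-05 gen 8 (prover-b2b-balaban-beta-d1-formalise-leaf-05-g8-0), 2026-08-20.
-/

noncomputable section

namespace Summit.QuantumFields.BalabanUV.Beta.FP.DecimationSecondMoment

open Finset fwdDiff
open Literature.Probability.LatticeModels (box mem_box annulus mem_annulus)
open Literature.MathematicalPhysics.QuantumFieldTheory.Balaban1983to89.Beta
open Literature.MathematicalPhysics.QuantumFieldTheory.Balaban1983to89.Beta.DyadicShell (Pt supNorm natAbs_le_supNorm mem_annulus_iff)
open CrossTermBounds (abs_cast_apply_le_supNorm)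
open Summit.QuantumFields.BalabanUV.Beta.FP.DecimationTail (decimation_tail_window)

variable {K : Fin 4 → Fin 4 → Pt → ℝ} {μ ν : Fin 4} {C : ℝ}

/-! ## §1 The second-moment weight of a kernel with sextic decay -/

/-- [folklore] **THE MOMENT WEIGHT HAS QUARTIC DECAY**: `|K μ ν z·z_μ·z_ν| ≤ C∕(‖z‖∞+1)⁴` from `|K μ ν z| ≤ C∕(‖z‖∞+1)⁶`. -/
theorem abs_momentWeight_le (hC : 0 ≤ C) (hK : ∀ z : Pt, |K μ ν z| ≤ C / ((supNorm z : ℝ) + 1) ^ 6) (z : Pt) :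
    |K μ ν z * (z μ : ℝ) * (z ν : ℝ)| ≤ C / ((supNorm z : ℝ) + 1) ^ 4 := by
  have hs : (0 : ℝ) ≤ (supNorm z : ℝ) := by positivity
  have h1 : |(z μ : ℝ)| ≤ (supNorm z : ℝ) + 1 := (abs_cast_apply_le_supNorm z μ).trans (by linarith)
  have h2 : |(z ν : ℝ)| ≤ (supNorm z : ℝ) + 1 := (abs_cast_apply_le_supNorm z ν).trans (by linarith)
  rw [abs_mul, abs_mul]
  have hKz := hK z
  have hq : 0 ≤ C / ((supNorm z : ℝ) + 1) ^ 6 := by positivity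
  calc |K μ ν z| * |(z μ : ℝ)| * |(z ν : ℝ)| ≤ C / ((supNorm z : ℝ) + 1) ^ 6 * ((supNorm z : ℝ) + 1) * ((supNorm z : ℝ) + 1) :=
        mul_le_mul (mul_le_mul hKz h1 (abs_nonneg _) hq) h2 (abs_nonneg _) (mul_nonneg hq (by positivity))
    _ = C / ((supNorm z : ℝ) + 1) ^ 4 := by field_simp

/-- [folklore] Stepping by a unit vector changes the sup norm by at most one: `‖z + e_i‖∞ ≤ ‖z‖∞ + 1`. -/
theorem supNorm_add_single_le (z : Pt) (i : Fin 4) : supNorm (z + Pi.single i 1) ≤ supNorm z + 1 := by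
  rw [DyadicShell.supNorm_le_iff]
  intro j
  have hj := natAbs_le_supNorm z j
  by_cases hji : j = i
  · subst hji; simp only [Pi.add_apply, Pi.single_eq_same]; omega
  · simp only [Pi.add_apply, Pi.single_eq_of_ne hji, add_zero]; omega

/-- [folklore] … and `‖z‖∞ ≤ ‖z + e_i‖∞ + 1`. -/
theorem supNorm_le_supNorm_add_single (z : Pt) (i : Fin 4) : supNorm z ≤ supNorm (z + Pi.single i 1) + 1 := by
  rw [DyadicShell.supNorm_le_iff]
  intro j
  have hj := natAbs_le_supNorm (z + Pi.single i 1) j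
  by_cases hji : j = i
  · subst hji; simp only [Pi.add_apply, Pi.single_eq_same] at hj; omega
  · simp only [Pi.add_apply, Pi.single_eq_of_ne hji, add_zero] at hj; omega

/-- [folklore] **THE FIRST DIFFERENCES OF THE MOMENT WEIGHT HAVE QUINTIC DECAY**: `|Δ_{e_i}(K μ ν·z_μ·z_ν)| ≤ 3C∕(‖z‖∞+1)⁵` from
`|K| ≤ C∕(‖z‖∞+1)⁶` and `|Δ_{e_i} K| ≤ C∕(‖z‖∞+1)⁷`. -/
theorem abs_fwdDiff_momentWeight_le (hC : 0 ≤ C) (hK : ∀ z : Pt, |K μ ν z| ≤ C / ((supNorm z : ℝ) + 1) ^ 6)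
    (hdK : ∀ (z : Pt) (i : Fin 4), |K μ ν (z + Pi.single i 1) - K μ ν z| ≤ C / ((supNorm z : ℝ) + 1) ^ 7) (z : Pt) (i : Fin 4) :
    |Δ_[(Pi.single i 1 : Pt)] (fun z : Pt => K μ ν z * (z μ : ℝ) * (z ν : ℝ)) z| ≤ 3 * C / ((supNorm z : ℝ) + 1) ^ 5 := by
  set s : ℝ := (supNorm z : ℝ) with hs
  have hs0 : (0 : ℝ) ≤ s := by positivity
  set z' : Pt := z + Pi.single i 1 with hz'
  -- coordinates of the shifted point move by at most one
  have hstep : ∀ j : Fin 4, |((z' j : ℤ) : ℝ) - (z j : ℝ)| ≤ 1 := by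
    intro j
    by_cases hji : j = i
    · subst hji; simp [hz', Pi.add_apply, Pi.single_eq_same]
    · simp [hz', Pi.add_apply, hji]
  have hsup' : (supNorm z' : ℝ) ≤ s + 1 := by rw [hs]; exact_mod_cast supNorm_add_single_le z i
  have hμ' : |((z' μ : ℤ) : ℝ)| ≤ s + 1 := (abs_cast_apply_le_supNorm z' μ).trans hsup'
  have hν' : |((z' ν : ℤ) : ℝ)| ≤ s + 1 := (abs_cast_apply_le_supNorm z' ν).trans hsup'
  have hμ : |(z μ : ℝ)| ≤ s := abs_cast_apply_le_supNorm z μ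
  -- the algebraic split `Δ(K·p) = ΔK · p' + K · Δp`
  have hsplit : Δ_[(Pi.single i 1 : Pt)] (fun z : Pt => K μ ν z * (z μ : ℝ) * (z ν : ℝ)) z
      = (K μ ν z' - K μ ν z) * (((z' μ : ℤ) : ℝ) * ((z' ν : ℤ) : ℝ))
        + K μ ν z * (((z' μ : ℤ) : ℝ) * ((z' ν : ℤ) : ℝ) - (z μ : ℝ) * (z ν : ℝ)) := by
    rw [fwdDiff]; ring
  -- the polynomial increment `|z'_μ z'_ν − z_μ z_ν| ≤ |z'_μ − z_μ|·|z'_ν| + |z_μ|·|z'_ν − z_ν| ≤ 2(s+1)`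
  have hpoly : |((z' μ : ℤ) : ℝ) * ((z' ν : ℤ) : ℝ) - (z μ : ℝ) * (z ν : ℝ)| ≤ 2 * (s + 1) := by
    have e : ((z' μ : ℤ) : ℝ) * ((z' ν : ℤ) : ℝ) - (z μ : ℝ) * (z ν : ℝ)
        = (((z' μ : ℤ) : ℝ) - (z μ : ℝ)) * ((z' ν : ℤ) : ℝ) + (z μ : ℝ) * (((z' ν : ℤ) : ℝ) - (z ν : ℝ)) := by ring
    rw [e]
    calc |(((z' μ : ℤ) : ℝ) - (z μ : ℝ)) * ((z' ν : ℤ) : ℝ) + (z μ : ℝ) * (((z' ν : ℤ) : ℝ) - (z ν : ℝ))|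
        ≤ |((z' μ : ℤ) : ℝ) - (z μ : ℝ)| * |((z' ν : ℤ) : ℝ)| + |(z μ : ℝ)| * |((z' ν : ℤ) : ℝ) - (z ν : ℝ)| := by
          refine (abs_add_le _ _).trans ?_; rw [abs_mul, abs_mul]
      _ ≤ 1 * (s + 1) + s * 1 := by
          gcongr
          · exact hstep μ
          · exact hstep ν
      _ ≤ 2 * (s + 1) := by linarith
  rw [hsplit]
  have hs1 : (0 : ℝ) < s + 1 := by linarith
  calc |(K μ ν z' - K μ ν z) * (((z' μ : ℤ) : ℝ) * ((z' ν : ℤ) : ℝ))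
          + K μ ν z * (((z' μ : ℤ) : ℝ) * ((z' ν : ℤ) : ℝ) - (z μ : ℝ) * (z ν : ℝ))|
      ≤ |K μ ν z' - K μ ν z| * (|((z' μ : ℤ) : ℝ)| * |((z' ν : ℤ) : ℝ)|)
          + |K μ ν z| * |((z' μ : ℤ) : ℝ) * ((z' ν : ℤ) : ℝ) - (z μ : ℝ) * (z ν : ℝ)| := by
        refine (abs_add_le _ _).trans ?_
        rw [abs_mul, abs_mul, abs_mul]
    _ ≤ C / (s + 1) ^ 7 * ((s + 1) * (s + 1)) + C / (s + 1) ^ 6 * (2 * (s + 1)) := by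
        have hdK' : |K μ ν z' - K μ ν z| ≤ C / (s + 1) ^ 7 := by rw [hz', hs]; exact hdK z i
        have hK' : |K μ ν z| ≤ C / (s + 1) ^ 6 := by rw [hs]; exact hK z
        have hq7 : 0 ≤ C / (s + 1) ^ 7 := by positivity
        have hq6 : 0 ≤ C / (s + 1) ^ 6 := by positivity
        exact add_le_add
          (mul_le_mul hdK' (mul_le_mul hμ' hν' (abs_nonneg _) (by linarith)) (by positivity) hq7)
          (mul_le_mul hK' hpoly (abs_nonneg _) hq6)
    _ = 3 * C / (s + 1) ^ 5 := by field_simp; ring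

/-! ## §2 The windowed second moment of the rescaled kernel against the window function -/

/-- [folklore] **THE SECOND BRACKET AGAINST THE WINDOW FUNCTION (decay only)**: for all `N, R ≥ 1`,
`|Σ_{1 < ‖v‖∞ ≤ R} (N⁶·K μ ν (N•v))·v_μ·v_ν − (g (N·R) − g N)| ≤ 67392·C`, where `g M := Σ_{0 < ‖z‖∞ ≤ M} K μ ν z·z_μ·z_ν`. -/
theorem abs_rescaled_window_sub_le (hC : 0 ≤ C) (hK : ∀ z : Pt, |K μ ν z| ≤ C / ((supNorm z : ℝ) + 1) ^ 6)
    (hdK : ∀ (z : Pt) (i : Fin 4), |K μ ν (z + Pi.single i 1) - K μ ν z| ≤ C / ((supNorm z : ℝ) + 1) ^ 7)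
    {N : ℕ} (hN : 1 ≤ N) {R : ℕ} (hR : 1 ≤ R) :
    |∑ v ∈ annulus 4 1 R, (N : ℝ) ^ 6 * K μ ν ((N : ℤ) • v) * (v μ : ℝ) * (v ν : ℝ)
        - (∑ z ∈ annulus 4 0 (N * R), K μ ν z * (z μ : ℝ) * (z ν : ℝ) - ∑ z ∈ annulus 4 0 N, K μ ν z * (z μ : ℝ) * (z ν : ℝ))|
      ≤ 67392 * C := by
  set F : Pt → ℝ := fun z => K μ ν z * (z μ : ℝ) * (z ν : ℝ) with hF
  have h0 : ∀ z : Pt, |F z| ≤ (3 * C) / ((supNorm z : ℝ) + 1) ^ 4 := by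
    intro z
    refine (abs_momentWeight_le hC hK z).trans ?_
    exact div_le_div_of_nonneg_right (by linarith) (by positivity)
  have h1 : ∀ (z : Pt) (i : Fin 4), |Δ_[(Pi.single i 1 : Pt)] F z| ≤ (3 * C) / ((supNorm z : ℝ) + 1) ^ 5 :=
    fun z i => abs_fwdDiff_momentWeight_le hC hK hdK z i
  have hmain := decimation_tail_window (A := 3 * C) (by positivity) h0 h1 hN hR
  -- the rescaled summand: `N⁴·F(N•v) = N⁶·K(N•v)·v_μ·v_ν`
  have hresc : (N : ℝ) ^ 4 * ∑ v ∈ annulus 4 1 R, F ((N : ℤ) • v)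
      = ∑ v ∈ annulus 4 1 R, (N : ℝ) ^ 6 * K μ ν ((N : ℤ) • v) * (v μ : ℝ) * (v ν : ℝ) := by
    rw [Finset.mul_sum]
    refine Finset.sum_congr rfl fun v _ => ?_
    simp only [hF, Pi.smul_apply, smul_eq_mul, Int.cast_mul, Int.cast_natCast]
    ring
  rw [hresc] at hmain
  linarith

/-! ## §3 With the log-asymptotics letter: the second bracket is `g R − c₀ + O(1)` -/

/-- [folklore] **THE SECOND BRACKET GIVEN THE GERM LETTER**: with `hgerm : ∀ M ≥ 1, |g M − (s·log M + c₀)| ≤ Cg` (road FP's (H2-c), a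
HYPOTHESIS), for all `N, R ≥ 1`: `|Σ_{1 < ‖v‖∞ ≤ R} (N⁶·K μ ν (N•v))·v_μ·v_ν − (g R − c₀)| ≤ 3·Cg + 67392·C`. -/
theorem abs_rescaled_window_sub_germ_le (hC : 0 ≤ C) (hK : ∀ z : Pt, |K μ ν z| ≤ C / ((supNorm z : ℝ) + 1) ^ 6)
    (hdK : ∀ (z : Pt) (i : Fin 4), |K μ ν (z + Pi.single i 1) - K μ ν z| ≤ C / ((supNorm z : ℝ) + 1) ^ 7)
    {s c₀ Cg : ℝ}
    (hgerm : ∀ M : ℕ, 1 ≤ M →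
      |∑ z ∈ annulus 4 0 M, K μ ν z * (z μ : ℝ) * (z ν : ℝ) - (s * Real.log M + c₀)| ≤ Cg)
    {N : ℕ} (hN : 1 ≤ N) {R : ℕ} (hR : 1 ≤ R) :
    |∑ v ∈ annulus 4 1 R, (N : ℝ) ^ 6 * K μ ν ((N : ℤ) • v) * (v μ : ℝ) * (v ν : ℝ)
        - (∑ z ∈ annulus 4 0 R, K μ ν z * (z μ : ℝ) * (z ν : ℝ) - c₀)| ≤ 3 * Cg + 67392 * C := by
  have hNR : 1 ≤ N * R := Nat.le_mul_of_pos_right N hR |>.trans' hN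
  have h1 := abs_rescaled_window_sub_le hC hK hdK hN hR
  have gNR := hgerm (N * R) hNR
  have gN := hgerm N hN
  have gR := hgerm R hR
  have hlog : Real.log ((N * R : ℕ) : ℝ) = Real.log N + Real.log R := by
    push_cast
    rw [Real.log_mul (by exact_mod_cast (by omega : N ≠ 0)) (by exact_mod_cast (by omega : R ≠ 0))]
  rw [hlog] at gNR
  rw [abs_le] at h1 gNR gN gR ⊢
  constructor <;> nlinarith [h1.1, h1.2, gNR.1, gNR.2, gN.1, gN.2, gR.1, gR.2]

end Summit.QuantumFields.BalabanUV.Beta.FP.DecimationSecondMoment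

end
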